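import Literature.MathematicalPhysics.QuantumFieldTheory.THooftDualityRotation
import Literature.MathematicalPhysics.QuantumFieldTheory.THooftElectricFluxStrongCoupling
import HarnessLib

/-!
# 't Hooft's exact duality equation (6.3) on the symmetric lattice four-torus

Topic `Literature/MathematicalPhysics/QuantumFieldTheory`; theorem-only sequel of `THooftDualityRotation.lean` ((6.2):
`MultiTwist.sun_twistZ_duality`, the dictionary `THooftFlux.magneticTensor`), `THooftElectricFlux.lean` ((5.4):
`THooftFlux.electricFluxWeight N L β m e = (1/N³) Σ_k e^{-2πi(k·e)/N} W{m + temporalTensor k}`, `fluxCharacter e k =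
e^{-2πi(k·e)/N}`) and `THooftElectricFluxStrongCoupling.lean` (`THooftFlux.sum_fluxCharacter`: orthogonality of the `ℤ_N`
characters).

## What is proved

G. 't Hooft, Nucl. Phys. B153 (1979) 141 [tHooft1979Flux], §6 (reprint p. 554): «The consequence of this [(6.2)] is
(6.3) `exp{-βF(ẽ, e₃, m̃, m₃; ã, a₃, β)} = N⁻² Σ_{k̃, l̃} exp{(2πi/N)[-(k̃·ẽ) + (l̃·m̃)] - a₃ F(l̃, e₃, k̃, m₃; â, β, a₃)}`.
Here `N⁻²` normalizes the Fourier transforms. … Eq. (6.3) will be referred to as the "duality equation". It must be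
stressed that so far no approximation has been made. Our duality equation (6.3) for pure non-Abelian gauge theories is
exact.»

★★★ `MultiTwist.sun_electricFluxWeight_duality` — (6.3) on the SYMMETRIC lattice torus `(ℤ/Lℤ)⁴` (all box sides
`a_μ = β = L` equal, so that both sides refer to the same box), for `SU(N)`, every `N`, every real coupling, every
`L ≥ 2`, all `e, m ∈ ℤ_N³`:
`w(e; m) = N⁻² Σ_{k̃, l̃ ∈ ℤ_N²} e^{-2πi(k̃·ẽ)/N} e^{+2πi(l̃·m̃)/N} w((l̃, e₃); (k̃, m₃))`,
where `w(e; m) = THooftFlux.electricFluxWeight N L β (magneticTensor m) e` is 't Hooft's `e^{-βF(e, m)}` of (5.4) in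
the magnetic sector `m` (dictionary `n_{ij} = ε_{ijk} m_k`), `x̃ = (x₁, x₂)` (`Fin.init`), and `(x̃, c)` is `Fin.snoc`.
Proof = 't Hooft's: insert (5.4) on the right, use the orthogonality `Σ_{l̃} e^{2πi l̃·(m̃ - k̃')/N} = N² [k̃' = m̃]`
(`sum_conj_fluxCharacter_mul`) to collapse the inner electric Fourier variable onto `k̃' = m̃`, apply (6.2)
(`sun_twistZ_duality`: `W{(m̃, c), (k̃, m₃)} = W{(k̃, c), (m̃, m₃)}`) termwise, and re-assemble (5.4) on the left.
The Fourier algebra is isolated in `fourier_duality` (any coefficient function `W` obeying (6.2)); `sum_pi_fin_succ` (private)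
splits the sums over `ℤ_N³` into `ℤ_N² × ℤ_N`.

Scope / HONEST FRAMING: finite symmetric torus; the exchange of box sides `(â, β, a₃)` in the printed (6.3) is
invisible here, and nothing about the limits `a_μ → ∞` or the light/heavy flux alternatives (§7) is asserted.

## References
* G. 't Hooft, Nucl. Phys. B153 (1979) 141–160, §5 eq. (5.4), §6 eqs. (6.2)–(6.3) (reprint: C. Rebbi (ed.), *Lattice
  Gauge Theories and Monte Carlo Simulations*, World Scientific, pp. 553–554). [tHooft1979Flux]
-/

open Finset Complex
open scoped ComplexConjugate BigOperators

namespace Literature.MathematicalPhysics.QuantumFieldTheory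

noncomputable section

namespace MultiTwist

open QuantumLattice THooftFlux

variable {N n : ℕ} [NeZero N]

/-! ## Fourier algebra on `ℤ_N^n` -/

/-- The Fourier kernel is symmetric: `e^{-2πi(k·e)/N} = e^{-2πi(e·k)/N}`. [cite: tHooft1979Flux, §5 eq. (5.4)] -/
theorem fluxCharacter_comm (e k : Fin n → ZMod N) : fluxCharacter e k = fluxCharacter k e := by
  unfold fluxCharacter
  exact Finset.prod_congr rfl fun j _ => by rw [mul_comm]

/-- Splitting off the last component of the kernel: `χ_e(k) = χ_ẽ(k̃) · e^{-2πi k_n e_n/N}`.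
[cite: tHooft1979Flux, §6 eq. (6.3)] -/
theorem fluxCharacter_eq_init_mul (e k : Fin (n + 1) → ZMod N) :
    fluxCharacter e k = fluxCharacter (Fin.init e) (Fin.init k) *
      (ZMod.stdAddChar (N := N)) (-(k (Fin.last n) * e (Fin.last n))) := by
  unfold fluxCharacter
  rw [Fin.prod_univ_castSucc]
  rfl

/-- Splitting a sum over `ℤ_N^{n+1}` into `ℤ_N^n × ℤ_N` (last component). [folklore] -/
private theorem sum_pi_fin_succ (g : (Fin (n + 1) → ZMod N) → ℂ) :
    ∑ k : Fin (n + 1) → ZMod N, g k = ∑ kt : Fin n → ZMod N, ∑ c : ZMod N, g (Fin.snoc kt c) := by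
  rw [← (Fin.snocEquiv (fun _ => ZMod N)).sum_comp, Fintype.sum_prod_type, Finset.sum_comm]
  rfl

/-- **Orthogonality** in the form used for (6.3): `Σ_{l̃} conj χ_{m̃}(l̃) χ_{l̃}(a) = N^n [a = m̃]`.
[cite: tHooft1979Flux, §5 eqs. (5.2)–(5.4) and §6 eq. (6.3) «N⁻² normalizes the Fourier transforms»] -/
theorem sum_conj_fluxCharacter_mul (mt a : Fin n → ZMod N) :
    ∑ lt : Fin n → ZMod N, conj (fluxCharacter mt lt) * fluxCharacter lt a =
      if a = mt then (N : ℂ) ^ n else 0 := by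
  have h : ∀ lt : Fin n → ZMod N, conj (fluxCharacter mt lt) * fluxCharacter lt a = fluxCharacter (a - mt) lt := by
    intro lt
    rw [fluxCharacter_comm mt lt, conj_fluxCharacter_mul lt mt a, fluxCharacter_comm]
  simp_rw [h]
  rw [sum_fluxCharacter]
  by_cases ham : a = mt
  · rw [if_pos (sub_eq_zero.2 ham), if_pos ham]
  · rw [if_neg (fun h' => ham (sub_eq_zero.1 h')), if_neg ham]

/-- **The Fourier algebra of the duality equation**: for ANY coefficient function `W(m, k)` on `ℤ_N³ × ℤ_N³`
(magnetic, temporal) obeying the (6.2)-symmetry `W{(m̃, c), (k̃, m₃)} = W{(k̃, c), (m̃, m₃)}`, its (5.4)-transform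
`w(e; m) = N⁻³ Σ_k χ_e(k) W(m, k)` satisfies `w(e; m) = N⁻² Σ_{k̃,l̃} χ_ẽ(k̃) conj χ_m̃(l̃) w((l̃, e₃); (k̃, m₃))`.
[cite: tHooft1979Flux, §6 eqs. (6.2)–(6.3)] -/
theorem fourier_duality (W : (Fin 3 → ZMod N) → (Fin 3 → ZMod N) → ℂ) (e m : Fin 3 → ZMod N)
    (hW : ∀ (kt : Fin 2 → ZMod N) (c : ZMod N),
      W (Fin.snoc kt (m 2)) (Fin.snoc (Fin.init m) c) = W m (Fin.snoc kt c)) :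
    ((N : ℂ) ^ 3)⁻¹ * ∑ k : Fin 3 → ZMod N, fluxCharacter e k * W m k =
      ((N : ℂ) ^ 2)⁻¹ * ∑ kt : Fin 2 → ZMod N, ∑ lt : Fin 2 → ZMod N,
        fluxCharacter (Fin.init e) kt * conj (fluxCharacter (Fin.init m) lt) *
          (((N : ℂ) ^ 3)⁻¹ * ∑ k' : Fin 3 → ZMod N, fluxCharacter (Fin.snoc lt (e 2)) k' * W (Fin.snoc kt (m 2)) k') := by
  have hN : ((N : ℂ) ^ 2) ≠ 0 := pow_ne_zero _ (Nat.cast_ne_zero.2 (NeZero.ne N))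
  -- the phase of the last component
  set s : ZMod N → ℂ := fun c => (ZMod.stdAddChar (N := N)) (-(c * e 2)) with hs
  -- Step A: split the kernel of the inner transform
  have hA : ∀ (lt : Fin 2 → ZMod N) (k' : Fin 3 → ZMod N),
      fluxCharacter (Fin.snoc lt (e 2)) k' = fluxCharacter lt (Fin.init k') * s (k' (Fin.last 2)) := by
    intro lt k'
    rw [fluxCharacter_eq_init_mul, Fin.init_snoc, Fin.snoc_last]
  -- Steps B–D for a fixed `kt`
  have hBCD : ∀ kt : Fin 2 → ZMod N,
      ∑ lt : Fin 2 → ZMod N, conj (fluxCharacter (Fin.init m) lt) *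
        ∑ k' : Fin 3 → ZMod N, fluxCharacter (Fin.snoc lt (e 2)) k' * W (Fin.snoc kt (m 2)) k' =
      (N : ℂ) ^ 2 * ∑ c : ZMod N, s c * W m (Fin.snoc kt c) := by
    intro kt
    -- B: exchange the sums and use orthogonality
    calc ∑ lt : Fin 2 → ZMod N, conj (fluxCharacter (Fin.init m) lt) *
          ∑ k' : Fin 3 → ZMod N, fluxCharacter (Fin.snoc lt (e 2)) k' * W (Fin.snoc kt (m 2)) k'
        = ∑ k' : Fin 3 → ZMod N, (∑ lt : Fin 2 → ZMod N,
            conj (fluxCharacter (Fin.init m) lt) * fluxCharacter lt (Fin.init k')) *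
            (s (k' (Fin.last 2)) * W (Fin.snoc kt (m 2)) k') := by
          simp_rw [Finset.mul_sum, Finset.sum_mul]
          rw [Finset.sum_comm]
          refine Finset.sum_congr rfl fun k' _ => Finset.sum_congr rfl fun lt _ => ?_
          rw [hA]
          ring
      _ = ∑ k' : Fin 3 → ZMod N, (if Fin.init k' = Fin.init m then (N : ℂ) ^ 2 else 0) *
            (s (k' (Fin.last 2)) * W (Fin.snoc kt (m 2)) k') :=
          Finset.sum_congr rfl fun k' _ => by rw [sum_conj_fluxCharacter_mul]
      -- C: only `k̃' = m̃` survives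
      _ = ∑ kt' : Fin 2 → ZMod N, ∑ c : ZMod N, (if kt' = Fin.init m then (N : ℂ) ^ 2 else 0) *
            (s c * W (Fin.snoc kt (m 2)) (Fin.snoc kt' c)) := by
          rw [sum_pi_fin_succ]
          refine Finset.sum_congr rfl fun kt' _ => Finset.sum_congr rfl fun c _ => ?_
          rw [Fin.init_snoc, Fin.snoc_last]
      _ = ∑ c : ZMod N, (N : ℂ) ^ 2 * (s c * W (Fin.snoc kt (m 2)) (Fin.snoc (Fin.init m) c)) := by
          rw [Finset.sum_comm]
          refine Finset.sum_congr rfl fun c _ => ?_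
          simp_rw [ite_mul, zero_mul]
          rw [Finset.sum_ite_eq' Finset.univ (Fin.init m), if_pos (Finset.mem_univ _)]
      -- D: the (6.2)-symmetry
      _ = (N : ℂ) ^ 2 * ∑ c : ZMod N, s c * W m (Fin.snoc kt c) := by
          rw [Finset.mul_sum]
          exact Finset.sum_congr rfl fun c _ => by rw [hW]
  -- Step E: the left-hand side split the same way
  have hE : ∑ k : Fin 3 → ZMod N, fluxCharacter e k * W m k =
      ∑ kt : Fin 2 → ZMod N, fluxCharacter (Fin.init e) kt * ∑ c : ZMod N, s c * W m (Fin.snoc kt c) := by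
    rw [sum_pi_fin_succ]
    refine Finset.sum_congr rfl fun kt _ => ?_
    rw [Finset.mul_sum]
    refine Finset.sum_congr rfl fun c _ => ?_
    rw [fluxCharacter_eq_init_mul, Fin.init_snoc, Fin.snoc_last]
    simp only [hs]
    rw [mul_assoc]
    rfl
  -- assemble
  rw [hE, Finset.mul_sum, Finset.mul_sum]
  refine Finset.sum_congr rfl fun kt _ => ?_
  have hfac : ∑ lt : Fin 2 → ZMod N, fluxCharacter (Fin.init e) kt * conj (fluxCharacter (Fin.init m) lt) *
      (((N : ℂ) ^ 3)⁻¹ * ∑ k' : Fin 3 → ZMod N, fluxCharacter (Fin.snoc lt (e 2)) k' * W (Fin.snoc kt (m 2)) k') =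
      fluxCharacter (Fin.init e) kt * ((N : ℂ) ^ 3)⁻¹ *
        ∑ lt : Fin 2 → ZMod N, conj (fluxCharacter (Fin.init m) lt) *
          ∑ k' : Fin 3 → ZMod N, fluxCharacter (Fin.snoc lt (e 2)) k' * W (Fin.snoc kt (m 2)) k' := by
    rw [Finset.mul_sum]
    exact Finset.sum_congr rfl fun lt _ => by ring
  rw [hfac, hBCD kt]
  field_simp

/-! ## The duality equation (6.3) -/

omit [NeZero N] in
/-- `(k̃, c)` as a `3`-vector: `![k̃₀, k̃₁, c] = Fin.snoc k̃ c`. [folklore] -/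
private theorem vec3_eq_snoc (kt : Fin 2 → ZMod N) (c : ZMod N) :
    (![kt 0, kt 1, c] : Fin 3 → ZMod N) = Fin.snoc kt c := by
  funext i
  fin_cases i <;> rfl

/-- ★★★ **'t Hooft's duality equation (6.3) on the symmetric lattice four-torus**: for `SU(N)`, every real `β`, every
`L ≥ 2` and all `e, m ∈ ℤ_N³`,
`e^{-βF(ẽ, e₃; m̃, m₃)} = N⁻² Σ_{k̃, l̃ ∈ ℤ_N²} e^{-2πi(k̃·ẽ)/N} e^{+2πi(l̃·m̃)/N} e^{-βF(l̃, e₃; k̃, m₃)}`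
— with `e^{-βF(e; m)} = THooftFlux.electricFluxWeight N L β (magneticTensor m) e` ((5.4) in the magnetic sector `m`,
dictionary `n_{ij} = ε_{ijk} m_k`), `x̃ = Fin.init x`, `(x̃, c) = Fin.snoc x̃ c`, and `conj χ_{m̃}(l̃) = e^{+2πi(l̃·m̃)/N}`.
«It must be stressed that so far no approximation has been made.» [cite: tHooft1979Flux, §6 eq. (6.3)] -/
theorem sun_electricFluxWeight_duality {L : ℕ} [NeZero L] (hL : 1 < L) (β : ℝ) (e m : Fin 3 → ZMod N) :
    electricFluxWeight N L β (magneticTensor m) e =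
      ((N : ℂ) ^ 2)⁻¹ * ∑ kt : Fin 2 → ZMod N, ∑ lt : Fin 2 → ZMod N,
        fluxCharacter (Fin.init e) kt * conj (fluxCharacter (Fin.init m) lt) *
          electricFluxWeight N L β (magneticTensor (Fin.snoc kt (m 2))) (Fin.snoc lt (e 2)) := by
  simp_rw [electricFluxWeight_def]
  refine fourier_duality (fun M K => (TwistedSector.twistZ (fundamentalRep (Fin N))
    (twistOfTensor N (magneticTensor M + temporalTensor K)) β L : ℂ)) e m fun kt c => ?_
  -- the (6.2)-symmetry `W{(m̃, c), (k̃, m₃)} = W{(k̃, c), (m̃, m₃)}`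
  have h := sun_twistZ_duality (N := N) hL β (Fin.snoc kt c) m
  have h1 : (![(Fin.snoc kt c : Fin 3 → ZMod N) 0, (Fin.snoc kt c : Fin 3 → ZMod N) 1, m 2] : Fin 3 → ZMod N) =
      Fin.snoc kt (m 2) := by
    rw [← vec3_eq_snoc kt (m 2)]
    rfl
  have h2 : (![m 0, m 1, (Fin.snoc kt c : Fin 3 → ZMod N) 2] : Fin 3 → ZMod N) = Fin.snoc (Fin.init m) c := by
    rw [← vec3_eq_snoc (Fin.init m) c]
    rfl
  rw [h1, h2] at h
  exact_mod_cast h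

end MultiTwist

end

end Literature.MathematicalPhysics.QuantumFieldTheory
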